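import Summits.HodgeConjecture.HodgeConjecture.Theorems.Ring2HypothesesDescentAbsoluteExteriorStabilizerPowersTower
import Summits.HodgeConjecture.HodgeConjecture.Theorems.Ring2HypothesesTannakaPricing
import Literature.AlgebraicGeometry.Milne1999.HodgeGroupProductsSplitting
import Literature.AlgebraicGeometry.HodgeTheory.HodgeConjectureIsogenyInvariance
import Literature.AlgebraicGeometry.Motives.TateAbelianFiniteLatticeProofs
import HarnessLib

/-!
# Ring 2 — hypotheses layer, descent axis: PRODUCTS — `G_P(B × C) ≤ G_P(B) × G_P(C)` FOR EVERY ADMISSIBLE SYSTEM OF CLASSES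
# (`S`, `G¹_alg`, `G¹_mot`, `G¹_AH`, `Hg`), the converse from a product-span hypothesis, and `HC`/the `HC_AV` bracket under a split Hodge group

HONEST FRAMING (page 1, verbatim the cell's standing line): **research route conditional on HC_CM; not a corollary;
Q11.4-sentence-2 already refuted in dim ≥ 3.** Nothing in this file proves a case of the Hodge conjecture; nothing discharges the
binder of record b06 `Ring2.Hypotheses.AbsoluteHodgeImpliesAlgebraicAV` («absolute Hodge classes on complex abelian varieties are
algebraic», `Ring2HypothesesDescent.lean` :73; OPEN); the binder table's numbers do not move. `HC_CM`
(`Theses.RankFourFaces.CMAbelianHodge`), `HC_AV` and row b06 are ABSENT from this file. Hodge ladder STAGE 3, `BINDER-OWNERS.md`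
row **b06**, seat `ring2-b06` (gen 87). It is the PRODUCTS chapter the powers files (gen 86,
`…ExteriorStabilizerPowers{,Tower,Prices,Similitude}`) list under "NOT obtained: products of non-isogenous factors (`G(A × B)` vs
`G(A) × G(B)`)", on the generic level; the Hodge-group case WITH ITS CONVERSE (Moonen–Zarhin 1999 (3.1), Tannaka-free) is the
Literature file `Milne1999/HodgeGroupProductsSplitting` (this seat, same gen), whose plumbing (shuffle `(B × C)^{a+1} ≅ B^{a+1} × C^{a+1}`,
powers of an intertwining retraction) is imported here.

THE SETTING (as in the powers files). A class notion `P : (N, Y, p) ↦ Set H²ᵖ(Y(ℂ); ℂ)`; its system on the powers of a complex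
abelian variety `B`, `a p ↦ P ((a+1) dim B) (B.X^{×(a+1)}) p`; its group `G_P(B) := powClassStabilizer B.X (that system)`. `P` is
ADMISSIBLE when (S) `G_P(B) ≤ S(B)` for all `B` and (Π) `P` is pull-back stable along homomorphisms — the displayed hypotheses
`hS`, `hP` (no definition); the five systems of the tower are admissible (`…StabilizerPowersTower` §1: `S`, `Hg`, `G¹_alg`, `G¹_mot`
fact-free; `G¹_AH` mod c23 + c35 + (E)).

* §1 `StabilizerProducts.mem_of_retraction` — **TRANSFER ALONG AN INTERTWINING RETRACTION** (admissible `P`): `ι : Z → Y`,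
  `π : Y → Z`, `ι ≫ π = 𝟙`, `u_Y ∘ π^* = π^* ∘ u_Z` on `H¹`, `⋀•u_Y ∈ G_P(Y) ⟹ ⋀•u_Z ∈ G_P(Z)` (the mechanism of the powers files,
  freed from powers by the Literature's `exists_retraction_powSucc_of_intertwine`).
* §2 `StabilizerProducts.exists_eq_prodBlockDiagEquiv` — **`G_P(B × C) ≤ G_P(B) × G_P(C)`**: every `g' ∈ G_P(B × C)` is
  `⋀•(u ⊕ v)` with `⋀•u ∈ G_P(B)`, `⋀•v ∈ G_P(C)` (`g'₁ ∈ C(B × C) ⊂ C(B) × C(C)` is block diagonal, Milne §1 p. 643; transfer of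
  the blocks along `B ⇄ B × C ⇆ C`); `H¹` form `…_of_mem_map_evalOne`. Instances (§4): `S(B × C) ≤ S(B) × S(C)` with NO
  hypothesis, `G¹_alg(B × C) ≤ G¹_alg(B) × G¹_alg(C)`, `G¹_mot(B × C) ≤ G¹_mot(B) × G¹_mot(C)` FACT-FREE, and
  **`G¹_AH(B × C) ≤ G¹_AH(B) × G¹_AH(C)`** mod c23 + c35 + (E) (the row's group).
* §3 `StabilizerProducts.prodBlockDiagEquiv_mem_of_forall_subset_span` — **THE CONVERSE FROM A PRODUCT-SPAN HYPOTHESIS**: if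
  for every `a` the `P`-classes of `B^{a+1} × C^{a+1}` lie in the span of the cross products `pr^* x ∪ pr^* y` of `P`-classes of
  `B^{a+1}`, `C^{a+1}`, then `⋀•(g₁ ⊕ k₁) ∈ G_P(B × C)` for all `g ∈ G_P(B)`, `k ∈ G_P(C)` — i.e. `G_P(B × C) = G_P(B) × G_P(C)`
  (through the shuffle `(B × C)^{a+1} ≅ B^{a+1} × C^{a+1}`, which intertwines the diagonals). For `P` = Hodge the hypothesis is
  `HodgeClassesProductSpan` on the powers and the implication is an EQUIVALENCE (Moonen–Zarhin (3.1), the Literature file).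
* §5 **UNDER A SPLIT HODGE GROUP** (Tannaka-free: `⋀•(u ⊕ v) ∈ Hg(B × C)` for all `u ∈ Hg(B)|_{H¹}`, `v ∈ Hg(C)|_{H¹}`):
  `HC` for all powers of `B` and of `C` ⟹ `HC` for all powers of `B × C` (`hodgeConjectureFor_powSucc_prod_of_split`, through the
  shuffle isogeny and the Literature's `hodgeConjectureFor_prod_of_productSpan`) ⟹ typer 2's `HC_AV` bracket
  `G¹_alg(B × C) ≤ Hg(B × C)` (`algebraicStabilizer_le_hodgeGroup_prod_of_split`) — the bracket is MULTIPLICATIVE over split pairs.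

HONEST COLUMN. No definition, no NEW named fact, no sorry. Displayed facts of record: c23 = V-B3 (`hZ`), c35 = (N) (`hN`) and the
existence of conjugates (E) (`hex`), in the two `G¹_AH` instances only; everything else FACT-FREE. As a SLICE nothing is new (no
class is proved algebraic); new are the GROUP statements for products in the Tannaka-free tower and the multiplicativity of `HC` on
all powers / of the bracket under a split Hodge group. NOT obtained: `S(B × C) = S(B) × S(C)` as an EQUALITY for `Hom`-orthogonal
pairs Tannaka-free (Milne Prop. 1.5; the lane has it on `H¹`, `LefschetzGroupProducts`, and gen 85's bijection `S(A) ≅ U(C(A) ⊗ ℂ, †)`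
would transport it — the Kähler normalisation of the product polarization is not assembled here); the converse of §2 for `G¹_alg`,
`G¹_mot`, `G¹_AH` beyond the displayed product-span hypothesis (false in general: graph classes); a criterion FOR the splitting of
`Hg(B × C)` (Hazama / Moonen–Zarhin (3.2) / Lombardo 3.4 / Gordon — the product programme's named facts, untouched); anything
deciding the row. PRESEARCH: Moonen–Zarhin 1999 §1, §3 (3.1) re-opened (`paper:arxiv-math_9901113` p0002, p0006); Milne 1999 §1
p. 643; corpus hybrid «Hodge group product abelian varieties Hodge ring generated factors» → Mumford–Tate-group monographs only;
galaxy all stars «Hodge group of a product|…» → 0 hits ⇒ certification by assembly on the tree's carriers, no novelty claimed.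
References (bib keys): MoonenZarhin1999LowDim (§1, §3 (3.1)), Milne1999LefschetzClasses (§1 p. 643, Prop. 1.5, Lemma 3.1, Def. 4.3,
Thm. 4.4, Cor. 4.7), Andre1996Motifs (§4.6 (ii), §6.2–6.3), Deligne1982HodgeCycles (I §3 Prop. 3.4, Thm. 3.8; §2 Ex. 2.1 (a)),
CharlesSchnell2014Notes ((11.2.2)–(11.2.3)), vanGeemen1994HodgeAV (Lemma 3.7, 6.4–6.5), LangeBirkenhake1992 (Thm. 4.2.1),
HatcherAT2002 (§3.2 Thm. 3.16), VoisinHodgeII2003 (proof of Prop. 9.20), FloccariFu2026 (§5).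
-/

noncomputable section

-- every declaration of this problem lives in `Summit.HodgeConjecture.HodgeConjecture.…` (summit = sub-problem)
set_option linter.dupNamespace false

namespace Summit.HodgeConjecture.HodgeConjecture.Ring2.Hypotheses

open CategoryTheory AlgebraicGeometry MonoidalCategory CartesianMonoidalCategory
open Literature.AlgebraicGeometry Literature.AlgebraicGeometry.Motives
open Literature.AlgebraicGeometry.HodgeTheory
open Literature.AlgebraicTopology.SingularHomology
open Literature.Barriers.HodgeConjecture (divisorClassesSpan)
open Literature.AlgebraicGeometry.VanGeemen1994 (hodgeGroupOne mem_hodgeGroupOne_iff)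
open Literature.AlgebraicGeometry.Milne1999 (specialLefschetzGroup centralizerGroup diagPow diagPowExterior exteriorPullbackEquiv
  prodBlockDiagEquiv)

/-! ## §1–§3 The generic theorems -/

namespace StabilizerProducts

variable {P : ∀ (_N : ℕ) (Y : SchemeOver ℂ) (p : ℕ), Set (complexBetti Y (2 * p))}
variable (hS : ∀ B : AbelianVariety ℂ,
    powClassStabilizer B.X (fun a p ↦ P (cartesianPowDim B.dim a) (cartesianPow B.X (a + 1)) p) ≤ specialLefschetzGroup B.dim B.X)
  (hP : ∀ ⦃B B' : AbelianVariety ℂ⦄ (f : B ⟶ B') ⦃p : ℕ⦄ ⦃c : complexBetti B'.X (2 * p)⦄,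
    c ∈ P B'.dim B'.X p → complexBetti.map f.hom.hom.hom (2 * p) c ∈ P B.dim B.X p)
include hS hP

/-- **§1 Transfer of `G_P`-membership along an intertwining retraction** (admissible `P`). Let `ι : Z → Y`, `π : Y → Z` be
homomorphisms with `ι ≫ π = 𝟙`, and `u_Y`, `u_Z` automorphisms of `H¹` with `u_Y ∘ π^* = π^* ∘ u_Z`. If `⋀•u_Y ∈ G_P(Y)` then
`⋀•u_Z ∈ G_P(Z)`: a `P`-class `c` of `Z^{a+1}` pulls back (Π) along the induced retraction `π_a : Y^{a+1} → Z^{a+1}`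
(`Milne1999.exists_retraction_powSucc_of_intertwine`) to a `P`-class of `Y^{a+1}`, fixed by the Künneth family `⋀•(u_Y^{⊕(a+1)})`
((S): `G_P(Y)` acts through `H¹`); `π_a^*` intertwines and is injective. [cite: MoonenZarhin1999LowDim, §1 and §3 (3.1)]
[cite: Milne1999LefschetzClasses, §1 p. 643] [cite: Andre1996Motifs, §6.2 (p. 31)] -/
theorem mem_of_retraction {Y Z : AbelianVariety ℂ} (ι : Z ⟶ Y) (π : Y ⟶ Z) (hιπ : ι ≫ π = 𝟙 Z)
    {uY : complexBetti Y.X 1 ≃ₗ[ℂ] complexBetti Y.X 1} {uZ : complexBetti Z.X 1 ≃ₗ[ℂ] complexBetti Z.X 1}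
    (h : ∀ y : complexBetti Z.X 1, uY (complexBetti.map π.hom.hom.hom 1 y) = complexBetti.map π.hom.hom.hom 1 (uZ y))
    (hY : (fun k ↦ exteriorPullbackEquiv (AbelianVariety.hasExteriorCohomologyH1_complexPoints Y) uY k) ∈
      powClassStabilizer Y.X (fun a p ↦ P (cartesianPowDim Y.dim a) (cartesianPow Y.X (a + 1)) p)) :
    (fun k ↦ exteriorPullbackEquiv (AbelianVariety.hasExteriorCohomologyH1_complexPoints Z) uZ k) ∈
      powClassStabilizer Z.X (fun a p ↦ P (cartesianPowDim Z.dim a) (cartesianPow Z.X (a + 1)) p) := by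
  refine StabilizerPowers.exteriorPullbackEquiv_mem_of_forall fun a p c hc ↦ ?_
  obtain ⟨ι', π', hιπ', hint⟩ := Milne1999.exists_retraction_powSucc_of_intertwine ι π hιπ uY uZ h a
  have hfix := StabilizerPowers.diagPowExterior_apply_eq_self (hS Y) hY a p (hP π' hc)
  rw [Milne1999.exteriorPullbackEquiv_one_eq, Milne1999.diagPowExterior, Milne1999.exteriorPullbackEquiv_apply,
    Milne1999.exteriorPullback_map_of_intertwine π' (diagPow Y uY a).toLinearMap (diagPow Z uZ a).toLinearMap (fun y ↦ hint y)] at hfix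
  have e := congrArg (complexBetti.map ι'.hom.hom.hom (2 * p)) hfix
  rwa [Milne1999.map_map_of_comp_eq_id hιπ', Milne1999.map_map_of_comp_eq_id hιπ', ← Milne1999.exteriorPullbackEquiv_apply] at e

/-- **§2 `G_P(B × C) ≤ G_P(B) × G_P(C)`** (admissible `P`): every `g' ∈ G_P(B × C)` is `⋀•(u ⊕ v)` for automorphisms `u` of
`H¹(B)`, `v` of `H¹(C)` with `⋀•u ∈ G_P(B)`, `⋀•v ∈ G_P(C)`. By (S) `g' = ⋀•(g'₁)` with `g'₁ ∈ C(B × C) ⊗ ℂ`, which is block diagonal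
(Milne §1 p. 643: `C(B × C) ⊂ C(B) × C(C)`, the lane's `prodBlockDiag_eq_of_mem_centralizerGroup`); the blocks transfer along
`(𝟙,0) : B ⇄ B × C : pr_B` and `(0,𝟙) : C ⇄ B × C : pr_C` (§1). Moonen–Zarhin (3.1), first sentence, for `Hg`; here for the whole
tower. [cite: MoonenZarhin1999LowDim, §3 (3.1)] [cite: Milne1999LefschetzClasses, §1 p. 643] [cite: Andre1996Motifs, §4.6 (ii) (p. 24)] -/
theorem exists_eq_prodBlockDiagEquiv (B C : AbelianVariety ℂ)
    {g' : ∀ k : ℕ, complexBetti (B.prod C).X k ≃ₗ[ℂ] complexBetti (B.prod C).X k}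
    (hg' : g' ∈ powClassStabilizer (B.prod C).X (fun a p ↦ P (cartesianPowDim (B.prod C).dim a) (cartesianPow (B.prod C).X (a + 1)) p)) :
    ∃ (u : complexBetti B.X 1 ≃ₗ[ℂ] complexBetti B.X 1) (v : complexBetti C.X 1 ≃ₗ[ℂ] complexBetti C.X 1),
      (fun k ↦ exteriorPullbackEquiv (AbelianVariety.hasExteriorCohomologyH1_complexPoints B) u k) ∈
          powClassStabilizer B.X (fun a p ↦ P (cartesianPowDim B.dim a) (cartesianPow B.X (a + 1)) p) ∧
        (fun k ↦ exteriorPullbackEquiv (AbelianVariety.hasExteriorCohomologyH1_complexPoints C) v k) ∈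
          powClassStabilizer C.X (fun a p ↦ P (cartesianPowDim C.dim a) (cartesianPow C.X (a + 1)) p) ∧
        g' = fun k ↦ exteriorPullbackEquiv (AbelianVariety.hasExteriorCohomologyH1_complexPoints (B.prod C)) (prodBlockDiagEquiv u v) k := by
  obtain ⟨hg'eq₀, h1⟩ := StabilizerPowers.eq_exteriorPullbackEquiv_and_mem_centralizerGroup (hS (B.prod C)) hg'
  set u := Milne1999.centralizerGroup.restrictFstHom B C ⟨g' 1, h1⟩ with hu
  set v := Milne1999.centralizerGroup.restrictSndHom B C ⟨g' 1, h1⟩ with hv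
  have hkey : prodBlockDiagEquiv u v = g' 1 := by
    refine LinearEquiv.toLinearMap_injective ?_
    rw [Milne1999.coe_prodBlockDiagEquiv, hu, hv, Milne1999.centralizerGroup.coe_restrictFstHom,
      Milne1999.centralizerGroup.coe_restrictSndHom]
    exact Milne1999.prodBlockDiag_eq_of_mem_centralizerGroup h1
  have hg'eq : g' = fun k ↦ exteriorPullbackEquiv (AbelianVariety.hasExteriorCohomologyH1_complexPoints (B.prod C))
      (prodBlockDiagEquiv u v) k := by
    rw [hkey]; exact hg'eq₀
  have hP' : (fun k ↦ exteriorPullbackEquiv (AbelianVariety.hasExteriorCohomologyH1_complexPoints (B.prod C))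
      (prodBlockDiagEquiv u v) k) ∈
        powClassStabilizer (B.prod C).X (fun a p ↦ P (cartesianPowDim (B.prod C).dim a) (cartesianPow (B.prod C).X (a + 1)) p) :=
    hg'eq ▸ hg'
  exact ⟨u, v,
    mem_of_retraction hS hP (AbelianVariety.prodLift (𝟙 B) (0 : B ⟶ C)) (AbelianVariety.fst B C) (AbelianVariety.prodLift_fst _ _)
      (fun y ↦ Milne1999.prodBlockDiagEquiv_apply_map_fst u v y) hP',
    mem_of_retraction hS hP (AbelianVariety.prodLift (0 : C ⟶ B) (𝟙 C)) (AbelianVariety.snd B C) (AbelianVariety.prodLift_snd _ _)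
      (fun y ↦ Milne1999.prodBlockDiagEquiv_apply_map_snd u v y) hP', hg'eq⟩

/-- **§2, `H¹` form: `G_P(B × C)|_{H¹} ⊆ {u ⊕ v | u ∈ G_P(B)|_{H¹}, v ∈ G_P(C)|_{H¹}}`.** [cite: MoonenZarhin1999LowDim, §3 (3.1)]
[cite: Milne1999LefschetzClasses, §1 p. 643] -/
theorem exists_eq_prodBlockDiagEquiv_of_mem_map_evalOne (B C : AbelianVariety ℂ)
    {U : complexBetti (B.prod C).X 1 ≃ₗ[ℂ] complexBetti (B.prod C).X 1}
    (hU : U ∈ (powClassStabilizer (B.prod C).X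
        (fun a p ↦ P (cartesianPowDim (B.prod C).dim a) (cartesianPow (B.prod C).X (a + 1)) p)).map
        (Pi.evalMonoidHom (fun k : ℕ ↦ complexBetti (B.prod C).X k ≃ₗ[ℂ] complexBetti (B.prod C).X k) 1)) :
    ∃ u ∈ (powClassStabilizer B.X (fun a p ↦ P (cartesianPowDim B.dim a) (cartesianPow B.X (a + 1)) p)).map
        (Pi.evalMonoidHom (fun k : ℕ ↦ complexBetti B.X k ≃ₗ[ℂ] complexBetti B.X k) 1),
      ∃ v ∈ (powClassStabilizer C.X (fun a p ↦ P (cartesianPowDim C.dim a) (cartesianPow C.X (a + 1)) p)).map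
        (Pi.evalMonoidHom (fun k : ℕ ↦ complexBetti C.X k ≃ₗ[ℂ] complexBetti C.X k) 1), U = prodBlockDiagEquiv u v := by
  obtain ⟨g', hg', rfl⟩ := Subgroup.mem_map.1 hU
  obtain ⟨u, v, hu, hv, hg'eq⟩ := exists_eq_prodBlockDiagEquiv hS hP B C hg'
  refine ⟨u, Subgroup.mem_map.2 ⟨_, hu, Milne1999.exteriorPullbackEquiv_one_eq _ _⟩,
    v, Subgroup.mem_map.2 ⟨_, hv, Milne1999.exteriorPullbackEquiv_one_eq _ _⟩, ?_⟩
  rw [Pi.evalMonoidHom_apply, congrFun hg'eq 1]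
  exact Milne1999.exteriorPullbackEquiv_one_eq _ _

/-- **§3 The converse from a product-span hypothesis: `G_P(B) × G_P(C) ≤ G_P(B × C)`** (admissible `P`). If for every `a` the
`P`-classes of `B^{a+1} × C^{a+1}` lie in the `ℂ`-span of the cross products `pr^* x ∪ pr^* y` of `P`-classes `x` of `B^{a+1}` and `y`
of `C^{a+1}`, then `⋀•(g₁ ⊕ k₁) ∈ G_P(B × C)` for all `g ∈ G_P(B)`, `k ∈ G_P(C)`: the Künneth family `⋀•((g₁ ⊕ k₁)^{⊕(a+1)})` fixes a
`P`-class `c` of `(B × C)^{a+1}` because, transported along the shuffle `σ : (B × C)^{a+1} ≅ B^{a+1} × C^{a+1}`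
(`Milne1999.exists_shuffle_powSucc_prod`, which intertwines `(g₁ ⊕ k₁)^{⊕(a+1)}` with `g₁^{⊕(a+1)} ⊕ k₁^{⊕(a+1)}`), `c` is a combination
of cross products, on which `⋀•(g₁^{⊕(a+1)} ⊕ k₁^{⊕(a+1)})` acts factorwise by `⋀•(g₁^{⊕(a+1)})`, `⋀•(k₁^{⊕(a+1)})` — trivially,
`G_P(B^{a+1}) ∋ ⋀•(g₁^{⊕(a+1)})` (powers, gen 86). Moonen–Zarhin (3.1) `⟸` for `Hg`; here for the whole tower.
[cite: MoonenZarhin1999LowDim, §1 and §3 (3.1)] [cite: Milne1999LefschetzClasses, Lemma 3.1 and §1 p. 643] -/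
theorem prodBlockDiagEquiv_mem_of_forall_subset_span (B C : AbelianVariety ℂ)
    (hspan : ∀ a p : ℕ, P ((B.powSucc a).prod (C.powSucc a)).dim ((B.powSucc a).prod (C.powSucc a)).X p ⊆
      Submodule.span ℂ {z | ∃ (l k : ℕ) (hlk : 2 * l + 2 * k = 2 * p) (x : complexBetti (B.powSucc a).X (2 * l))
        (y : complexBetti (C.powSucc a).X (2 * k)), x ∈ P (B.powSucc a).dim (B.powSucc a).X l ∧ y ∈ P (C.powSucc a).dim (C.powSucc a).X k ∧
          z = cupProduct hlk (complexBetti.map (AbelianVariety.fst (B.powSucc a) (C.powSucc a)).hom.hom.hom (2 * l) x)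
            (complexBetti.map (AbelianVariety.snd (B.powSucc a) (C.powSucc a)).hom.hom.hom (2 * k) y)})
    {g : ∀ k : ℕ, complexBetti B.X k ≃ₗ[ℂ] complexBetti B.X k}
    (hg : g ∈ powClassStabilizer B.X (fun a p ↦ P (cartesianPowDim B.dim a) (cartesianPow B.X (a + 1)) p))
    {k : ∀ i : ℕ, complexBetti C.X i ≃ₗ[ℂ] complexBetti C.X i}
    (hk : k ∈ powClassStabilizer C.X (fun a p ↦ P (cartesianPowDim C.dim a) (cartesianPow C.X (a + 1)) p)) :
    (fun i ↦ exteriorPullbackEquiv (AbelianVariety.hasExteriorCohomologyH1_complexPoints (B.prod C)) (prodBlockDiagEquiv (g 1) (k 1)) i) ∈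
      powClassStabilizer (B.prod C).X (fun a p ↦ P (cartesianPowDim (B.prod C).dim a) (cartesianPow (B.prod C).X (a + 1)) p) := by
  refine StabilizerPowers.exteriorPullbackEquiv_mem_of_forall fun a p c hc ↦ ?_
  obtain ⟨σ, τ, hστ, -, hint⟩ := Milne1999.exists_shuffle_powSucc_prod B C a
  -- `⋀•(g₁^{⊕(a+1)} ⊕ k₁^{⊕(a+1)})` fixes the span of the cross products of `P`-classes, hence the `P`-class `τ^* c`
  have key : ∀ z ∈ Submodule.span ℂ {z | ∃ (l k : ℕ) (hlk : 2 * l + 2 * k = 2 * p) (x : complexBetti (B.powSucc a).X (2 * l))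
      (y : complexBetti (C.powSucc a).X (2 * k)), x ∈ P (B.powSucc a).dim (B.powSucc a).X l ∧ y ∈ P (C.powSucc a).dim (C.powSucc a).X k ∧
        z = cupProduct hlk (complexBetti.map (AbelianVariety.fst (B.powSucc a) (C.powSucc a)).hom.hom.hom (2 * l) x)
          (complexBetti.map (AbelianVariety.snd (B.powSucc a) (C.powSucc a)).hom.hom.hom (2 * k) y)},
      exteriorPullback (AbelianVariety.hasExteriorCohomologyH1_complexPoints ((B.powSucc a).prod (C.powSucc a)))
        (prodBlockDiagEquiv (diagPow B (g 1) a) (diagPow C (k 1) a)).toLinearMap (2 * p) z = z := by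
    intro z hz
    induction hz using Submodule.span_induction with
    | mem z hz =>
      obtain ⟨l, k', hlk, x, y, hx, hy, rfl⟩ := hz
      rw [Milne1999.exteriorPullback_prodBlockDiagEquiv_cross, ← Milne1999.exteriorPullbackEquiv_apply, ← Milne1999.exteriorPullbackEquiv_apply]
      change cupProduct hlk (complexBetti.map _ (2 * l) (diagPowExterior B (g 1) a (2 * l) x))
          (complexBetti.map _ (2 * k') (diagPowExterior C (k 1) a (2 * k') y)) = _
      rw [StabilizerPowers.diagPowExterior_apply_eq_self (hS B) hg a l hx, StabilizerPowers.diagPowExterior_apply_eq_self (hS C) hk a k' hy]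
    | zero => exact map_zero _
    | add z w _ _ hz hw => rw [map_add, hz, hw]
    | smul t z _ hz => rw [map_smul, hz]
  have hfix := key _ (hspan a p (hP τ hc))
  rw [← Milne1999.map_map_of_comp_eq_id hστ (2 * p) c, Milne1999.diagPowExterior, Milne1999.exteriorPullbackEquiv_apply,
    Milne1999.exteriorPullback_map_of_intertwine σ (diagPow (B.prod C) (prodBlockDiagEquiv (g 1) (k 1)) a).toLinearMap
      (prodBlockDiagEquiv (diagPow B (g 1) a) (diagPow C (k 1) a)).toLinearMap (fun y ↦ hint (g 1) (k 1) y), hfix]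

end StabilizerProducts

/-! ## §4 Instances: `S`, `G¹_alg`, `G¹_mot` (fact-free), `G¹_AH` (mod c23 + c35 + (E)) of a product are block diagonal with blocks in the factors' groups -/

section Instances

variable (B C : AbelianVariety ℂ)

/-- **`S(B × C) ≤ S(B) × S(C)`, no hypothesis**: every element of Milne's special Lefschetz group of `B × C` (Tannaka-free) is
`⋀•(u ⊕ v)` with `⋀•u ∈ S(B)`, `⋀•v ∈ S(C)` (Milne §1 p. 643 `C(A₁ × A₂) ⊂ C(A₁) × C(A₂)` + Thm. 4.4; equality needs `Hom(B, C) = 0`,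
Prop. 1.5, not recorded here). [cite: Milne1999LefschetzClasses, §1 p. 643, Prop. 1.5 and Thm. 4.4] -/
theorem exists_eq_prodBlockDiagEquiv_of_mem_specialLefschetzGroup_prod
    {g' : ∀ k : ℕ, complexBetti (B.prod C).X k ≃ₗ[ℂ] complexBetti (B.prod C).X k}
    (hg' : g' ∈ specialLefschetzGroup (B.prod C).dim (B.prod C).X) :
    ∃ (u : complexBetti B.X 1 ≃ₗ[ℂ] complexBetti B.X 1) (v : complexBetti C.X 1 ≃ₗ[ℂ] complexBetti C.X 1),
      (fun k ↦ exteriorPullbackEquiv (AbelianVariety.hasExteriorCohomologyH1_complexPoints B) u k) ∈ specialLefschetzGroup B.dim B.X ∧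
        (fun k ↦ exteriorPullbackEquiv (AbelianVariety.hasExteriorCohomologyH1_complexPoints C) v k) ∈ specialLefschetzGroup C.dim C.X ∧
        g' = fun k ↦ exteriorPullbackEquiv (AbelianVariety.hasExteriorCohomologyH1_complexPoints (B.prod C)) (prodBlockDiagEquiv u v) k := by
  have h := @StabilizerProducts.exists_eq_prodBlockDiagEquiv (fun N Y p ↦ (divisorClassesSpan Y N p : Set _))
    specialLefschetzGroup_admissibleS divisorClassesSpan_admissibleP B C g'
  exact h hg'

/-- **`G¹_alg(B × C) ≤ G¹_alg(B) × G¹_alg(C)`, FACT-FREE** (typer 2's algebraic stabiliser).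
[cite: Andre1996Motifs, §4.6 (ii) (p. 24) and §6.2 (p. 31)] [cite: Milne1999LefschetzClasses, §1 p. 643] -/
theorem exists_eq_prodBlockDiagEquiv_of_mem_algebraicStabilizer_prod
    {g' : ∀ k : ℕ, complexBetti (B.prod C).X k ≃ₗ[ℂ] complexBetti (B.prod C).X k} (hg' : g' ∈ algebraicStabilizer (B.prod C).X) :
    ∃ (u : complexBetti B.X 1 ≃ₗ[ℂ] complexBetti B.X 1) (v : complexBetti C.X 1 ≃ₗ[ℂ] complexBetti C.X 1),
      (fun k ↦ exteriorPullbackEquiv (AbelianVariety.hasExteriorCohomologyH1_complexPoints B) u k) ∈ algebraicStabilizer B.X ∧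
        (fun k ↦ exteriorPullbackEquiv (AbelianVariety.hasExteriorCohomologyH1_complexPoints C) v k) ∈ algebraicStabilizer C.X ∧
        g' = fun k ↦ exteriorPullbackEquiv (AbelianVariety.hasExteriorCohomologyH1_complexPoints (B.prod C)) (prodBlockDiagEquiv u v) k :=
  @StabilizerProducts.exists_eq_prodBlockDiagEquiv (fun _ Y p ↦ (algebraicClasses Y p : Set _))
    algebraicStabilizer_admissibleS algebraicClasses_admissibleP B C g' hg'

/-- **`G¹_mot(B × C) ≤ G¹_mot(B) × G¹_mot(C)`, FACT-FREE** (André's special motivated Galois group, Tannaka-free).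
[cite: Andre1996Motifs, §4.6 (ii) (p. 24) and Prop. 2.1 (ii)] [cite: Milne1999LefschetzClasses, §1 p. 643] -/
theorem exists_eq_prodBlockDiagEquiv_of_mem_specialMotivatedGaloisGroup_prod
    {g' : ∀ k : ℕ, complexBetti (B.prod C).X k ≃ₗ[ℂ] complexBetti (B.prod C).X k}
    (hg' : g' ∈ specialMotivatedGaloisGroup (B.prod C).dim (B.prod C).X) :
    ∃ (u : complexBetti B.X 1 ≃ₗ[ℂ] complexBetti B.X 1) (v : complexBetti C.X 1 ≃ₗ[ℂ] complexBetti C.X 1),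
      (fun k ↦ exteriorPullbackEquiv (AbelianVariety.hasExteriorCohomologyH1_complexPoints B) u k) ∈ specialMotivatedGaloisGroup B.dim B.X ∧
        (fun k ↦ exteriorPullbackEquiv (AbelianVariety.hasExteriorCohomologyH1_complexPoints C) v k) ∈ specialMotivatedGaloisGroup C.dim C.X ∧
        g' = fun k ↦ exteriorPullbackEquiv (AbelianVariety.hasExteriorCohomologyH1_complexPoints (B.prod C)) (prodBlockDiagEquiv u v) k := by
  have h := @StabilizerProducts.exists_eq_prodBlockDiagEquiv (fun N Y p ↦ (motivatedClasses N Y p : Set _))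
    specialMotivatedGaloisGroup_admissibleS motivatedClasses_admissibleP B C g'
  exact h hg'

/-- **`G¹_AH(B × C) ≤ G¹_AH(B) × G¹_AH(C)`** — THE ROW'S GROUP ON A PRODUCT (mod c23 = V-B3 `hZ`, c35 = (N) `hN`, and the existence of
conjugates (E) `hex`, displayed): every element of the absolute Hodge stabiliser of `B × C` is `⋀•(u ⊕ v)` with `⋀•u ∈ G¹_AH(B)`,
`⋀•v ∈ G¹_AH(C)`. [cite: Deligne1982HodgeCycles, I §3 Thm. 3.8 and §2 Ex. 2.1 (a)] [cite: CharlesSchnell2014Notes, §11.2.2 (11.2.2)–(11.2.3)]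
[cite: Milne1999LefschetzClasses, §1 p. 643] -/
theorem exists_eq_prodBlockDiagEquiv_of_mem_absoluteHodgeStabilizer_prod (hZ : deligne1982_cycleClass_absoluteHodge)
    (hN : chartConjugation_canonical)
    (hex : ∀ ⦃n : ℕ⦄ ⦃X : SchemeOver ℂ⦄, IsSmoothProjective n X →
      ∀ (σ : ℂ ≃+* ℂ) (p : ℕ) (c : complexBetti X (2 * p)), ∃ s, IsConjugateClass σ X (2 * p) c s)
    {g' : ∀ k : ℕ, complexBetti (B.prod C).X k ≃ₗ[ℂ] complexBetti (B.prod C).X k}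
    (hg' : g' ∈ powClassStabilizer (B.prod C).X (fun a p ↦ {c : complexBetti (cartesianPow (B.prod C).X (a + 1)) (2 * p) |
      IsAbsoluteHodgeClass (cartesianPowDim (B.prod C).dim a) (cartesianPow (B.prod C).X (a + 1)) p c})) :
    ∃ (u : complexBetti B.X 1 ≃ₗ[ℂ] complexBetti B.X 1) (v : complexBetti C.X 1 ≃ₗ[ℂ] complexBetti C.X 1),
      (fun k ↦ exteriorPullbackEquiv (AbelianVariety.hasExteriorCohomologyH1_complexPoints B) u k) ∈
          powClassStabilizer B.X (fun a p ↦ {c : complexBetti (cartesianPow B.X (a + 1)) (2 * p) |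
            IsAbsoluteHodgeClass (cartesianPowDim B.dim a) (cartesianPow B.X (a + 1)) p c}) ∧
        (fun k ↦ exteriorPullbackEquiv (AbelianVariety.hasExteriorCohomologyH1_complexPoints C) v k) ∈
          powClassStabilizer C.X (fun a p ↦ {c : complexBetti (cartesianPow C.X (a + 1)) (2 * p) |
            IsAbsoluteHodgeClass (cartesianPowDim C.dim a) (cartesianPow C.X (a + 1)) p c}) ∧
        g' = fun k ↦ exteriorPullbackEquiv (AbelianVariety.hasExteriorCohomologyH1_complexPoints (B.prod C)) (prodBlockDiagEquiv u v) k :=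
  @StabilizerProducts.exists_eq_prodBlockDiagEquiv (fun N Y p ↦ {c : complexBetti Y (2 * p) | IsAbsoluteHodgeClass N Y p c})
    (absoluteHodgeStabilizer_admissibleS hZ) (absoluteHodgeClasses_admissibleP hN hex) B C g' hg'

/-- The Hodge-group instance is the Literature's (Moonen–Zarhin (3.1), first sentence): recorded here in the uniform shape of this
file, from the generic theorem with `P` = rational `(p,p)`-classes. [cite: MoonenZarhin1999LowDim, §3 (3.1)] -/
theorem exists_eq_prodBlockDiagEquiv_of_mem_hodgeGroup_prod
    {g' : ∀ k : ℕ, complexBetti (B.prod C).X k ≃ₗ[ℂ] complexBetti (B.prod C).X k} (hg' : g' ∈ hodgeGroup (B.prod C).dim (B.prod C).X) :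
    ∃ (u : complexBetti B.X 1 ≃ₗ[ℂ] complexBetti B.X 1) (v : complexBetti C.X 1 ≃ₗ[ℂ] complexBetti C.X 1),
      (fun k ↦ exteriorPullbackEquiv (AbelianVariety.hasExteriorCohomologyH1_complexPoints B) u k) ∈ hodgeGroup B.dim B.X ∧
        (fun k ↦ exteriorPullbackEquiv (AbelianVariety.hasExteriorCohomologyH1_complexPoints C) v k) ∈ hodgeGroup C.dim C.X ∧
        g' = fun k ↦ exteriorPullbackEquiv (AbelianVariety.hasExteriorCohomologyH1_complexPoints (B.prod C)) (prodBlockDiagEquiv u v) k :=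
  @StabilizerProducts.exists_eq_prodBlockDiagEquiv (fun N Y p ↦ {c : complexBetti Y (2 * p) | IsRationalClass c ∧ IsOfHodgeType N Y (2 * p) p p c})
    hodgeGroup_admissibleS hodgeClasses_admissibleP B C g' hg'

end Instances

/-! ## §5 Under a split Hodge group: `HC` on all powers and the `HC_AV` bracket are multiplicative -/

section Split

variable (B C : AbelianVariety ℂ)

/-- The shuffle `(B × C)^{a+1} ≅ B^{a+1} × C^{a+1}` and its inverse are isogenies (isomorphisms). [cite: LangeBirkenhake1992, Thm. 4.2.1] [cite: MumfordAV1970, §19] -/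
theorem exists_isIsogeny_powSucc_prod (a : ℕ) :
    ∃ (σ : (B.prod C).powSucc a ⟶ (B.powSucc a).prod (C.powSucc a)) (τ : (B.powSucc a).prod (C.powSucc a) ⟶ (B.prod C).powSucc a),
      σ ≫ τ = 𝟙 _ ∧ τ ≫ σ = 𝟙 _ ∧ AbelianVariety.IsIsogeny σ ∧ AbelianVariety.IsIsogeny τ := by
  obtain ⟨σ, τ, hστ, hτσ, -⟩ := Milne1999.exists_shuffle_powSucc_prod B C a
  exact ⟨σ, τ, hστ, hτσ,
    AbelianVariety.isIsogeny_of_comp_eq_of_comp_eq (AbelianVariety.isIsogeny_id _) (AbelianVariety.isIsogeny_id _) hτσ hστ,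
    AbelianVariety.isIsogeny_of_comp_eq_of_comp_eq (AbelianVariety.isIsogeny_id _) (AbelianVariety.isIsogeny_id _) hστ hτσ⟩

/-- **`HC` IS MULTIPLICATIVE ON ALL POWERS UNDER A SPLIT HODGE GROUP**: if `⋀•(u ⊕ v) ∈ Hg(B × C)` for all `u ∈ Hg(B)|_{H¹}`,
`v ∈ Hg(C)|_{H¹}` (Tannaka-free splitting) and the Hodge conjecture holds for `B^{a+1}` and `C^{a+1}`, then it holds for `(B × C)^{a+1}`
— Moonen–Zarhin (3.1) `⟹` on the power `a` (the Literature's `hodgeConjectureFor_powSucc_prod_powSucc_of_forall_prodBlockDiagEquiv_mem`: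
the Hodge classes of `B^{a+1} × C^{a+1}` are exterior products, hence algebraic) and the shuffle isogeny (van Geemen Lemma 3.7,
`HodgeConjectureFor.of_isIsogeny`). Each conclusion is a case of the summit statement GIVEN the Hodge conjecture for the factors'
powers — nothing unconditional is claimed. [cite: MoonenZarhin1999LowDim, §3 (3.1)] [cite: vanGeemen1994HodgeAV, Lemma 3.7] -/
theorem hodgeConjectureFor_powSucc_prod_of_split
    (hsplit : ∀ u ∈ hodgeGroupOne B.dim B.X, ∀ v ∈ hodgeGroupOne C.dim C.X,
      (fun k ↦ exteriorPullbackEquiv (AbelianVariety.hasExteriorCohomologyH1_complexPoints (B.prod C)) (prodBlockDiagEquiv u v) k) ∈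
        hodgeGroup (B.prod C).dim (B.prod C).X)
    (a : ℕ) (hB : HodgeConjectureFor (B.powSucc a).dim (B.powSucc a).X) (hC : HodgeConjectureFor (C.powSucc a).dim (C.powSucc a).X) :
    HodgeConjectureFor ((B.prod C).powSucc a).dim ((B.prod C).powSucc a).X := by
  obtain ⟨-, τ, -, -, -, hτ⟩ := exists_isIsogeny_powSucc_prod B C a
  exact HodgeConjectureFor.of_isIsogeny τ hτ
    (Milne1999.hodgeConjectureFor_powSucc_prod_powSucc_of_forall_prodBlockDiagEquiv_mem B C hsplit a hB hC)

/-- The same conclusion read on the cartesian power `(B × C).X^{×(a+1)}` (dimension `(a+1)(dim B + dim C)`), the shape in which the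
powers are priced by typer 2's dictionary. [cite: MoonenZarhin1999LowDim, §3 (3.1)] -/
theorem hodgeConjectureFor_cartesianPow_prod_of_split
    (hsplit : ∀ u ∈ hodgeGroupOne B.dim B.X, ∀ v ∈ hodgeGroupOne C.dim C.X,
      (fun k ↦ exteriorPullbackEquiv (AbelianVariety.hasExteriorCohomologyH1_complexPoints (B.prod C)) (prodBlockDiagEquiv u v) k) ∈
        hodgeGroup (B.prod C).dim (B.prod C).X)
    (a : ℕ) (hB : HodgeConjectureFor (B.powSucc a).dim (B.powSucc a).X) (hC : HodgeConjectureFor (C.powSucc a).dim (C.powSucc a).X) :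
    HodgeConjectureFor (cartesianPowDim (B.prod C).dim a) (cartesianPow (B.prod C).X (a + 1)) := by
  rw [← AbelianVariety.powSucc_X_eq_cartesianPow, ← AbelianVariety.dim_powSucc_eq_cartesianPowDim]
  exact hodgeConjectureFor_powSucc_prod_of_split B C hsplit a hB hC

/-- **THE `HC_AV` BRACKET IS MULTIPLICATIVE OVER SPLIT PAIRS**: if `Hg(B × C)` splits (Tannaka-free) and the Hodge conjecture holds
for all powers of `B` and of `C`, then `G¹_alg(B × C) ≤ Hg(B × C)` — typer 2's price of `HC` on all powers
(`algebraicStabilizer_le_hodgeGroup_of_forall_hodgeConjectureFor`, fact-free direction) at the product. [cite: MoonenZarhin1999LowDim, §3 (3.1)]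
[cite: Andre1996Motifs, §6.3 (p. 31)] [cite: FloccariFu2026, §5 (p. 13)] -/
theorem algebraicStabilizer_le_hodgeGroup_prod_of_split
    (hsplit : ∀ u ∈ hodgeGroupOne B.dim B.X, ∀ v ∈ hodgeGroupOne C.dim C.X,
      (fun k ↦ exteriorPullbackEquiv (AbelianVariety.hasExteriorCohomologyH1_complexPoints (B.prod C)) (prodBlockDiagEquiv u v) k) ∈
        hodgeGroup (B.prod C).dim (B.prod C).X)
    (hB : ∀ a : ℕ, HodgeConjectureFor (B.powSucc a).dim (B.powSucc a).X)
    (hC : ∀ a : ℕ, HodgeConjectureFor (C.powSucc a).dim (C.powSucc a).X) :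
    algebraicStabilizer (B.prod C).X ≤ hodgeGroup (B.prod C).dim (B.prod C).X :=
  algebraicStabilizer_le_hodgeGroup_of_forall_hodgeConjectureFor (B.prod C) fun a ↦
    hodgeConjectureFor_cartesianPow_prod_of_split B C hsplit a (hB a) (hC a)

end Split

end Summit.HodgeConjecture.HodgeConjecture.Ring2.Hypotheses

end
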